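import Summits.AtomisticToContinuum.BoseEinsteinCondensation.Theses.BECCutLineWeakDisorder
import Summits.AtomisticToContinuum.BoseEinsteinCondensation.Theorems.BECCutLineWeakDisorderLandscapeBoundSiblingDefs
import Summits.AtomisticToContinuum.BoseEinsteinCondensation.Theorems.BECCutLineWeakDisorderLandscapeBoundSiblingTelescope
import Summits.AtomisticToContinuum.BoseEinsteinCondensation.Theorems.BECCutLineWeakDisorderLandscapeBoundSiblingCompose
import Summits.AtomisticToContinuum.BoseEinsteinCondensation.Theorems.BECCutLineWeakDisorderTwoReplicaTransienceBoundMeanFreeWindow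
import Literature.MathematicalPhysics.QuantumManyBody.GroundStateFeynmanKacCutLine
import HarnessLib

/-!
# Route `BECCutLineWeakDisorder`, crux `TwoReplicaTransienceBound` (stmt-AtomisticToContinuum-9687):
# vocabulary and stub statements of the line `tagged-shift-log-harnack`

Route-posited objects (D-0016 `<Route>Defs`-style file; precedents
`Theorems/BECCutLineWeakDisorderDefs.lean` (line `SketchIdeator1` of this crux) and
`Theorems/BECCutLineWeakDisorderLandscapeBoundSiblingDefs.lean` (sibling crux `LandscapeBound`)) shared
by the registered stubs of the checked skeleton
`Cruxes/TwoReplicaTransienceBound/Lines/tagged_shift_log_harnack.lean` (line card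
`Cruxes/TwoReplicaTransienceBound/Lines/tagged-shift-log-harnack.md`, idea card
`Cruxes/TwoReplicaTransienceBound/Ideas/tagged-shift-log-harnack.md`, lead a1) and by the files that
prove / compose them. NOTHING IS ASSERTED here: `kineticDepth`, `blockSqMass`, `blockParticipation`
are honest definitions over the sibling block vocabulary (`dyadicCube`, `blockMass`, `levelSq`,
`uvParticipation`, `siblingExcess`, `slice`) and `GroundStateFeynmanKacCutLine.lean` (`fkWitness`,
`fkWeight`, `fkNormSq`, `worldLine`, `wienerPaths`); every `def … : Prop` is a *statement* (a
registered stub signature), consumed only as the type of a stub theorem or as a hypothesis of the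
sorry-free composition of the line, and ONE registered bookkeeping stub is PROVED here
(`stub_taggedShiftCompose`, the composition `TwoReplicaTransienceBound_of`).

**The crux** (`Theses/BECCutLineWeakDisorder.lean`, `def TwoReplicaTransienceBound`): for admissible
`v`, `0 < ρ < ρ₀(v)`, some `C`, all large `n` and EVERY half-length `T ≥ 1`, the flat-datum
Feynman–Kac witness `Ψ_T = fkWitness v L T 1` (`L = sideLength ρ (n+1)`) has
`∫ L³ m_T(Y)²/s_T(Y)² dY ≤ C` (`m_T(Y) = ∫Ψ_T(x,Y)²dx`, `s_T(Y) = ∫Ψ_T(x,Y)dx`).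

**The line (kinetic split + log-Harnack by a shift of the tagged coordinate).** Split the polymer
half-length at the KINETIC TIME `Aκ/ρ` and the box at the KINETIC LENGTH `√(κ/ρ)`
(`kineticDepth`: dyadic blocks of side `∈ (√(κ/ρ)/16, √(κ/ρ)]`). For `T ≤ Aκ/ρ` the crux is the
LANDED mean-free window (`TracerDecoupling.stub_meanFreeWindow`, constant `20`). For `T ≥ Aκ/ρ`,
slice by slice `L³m²/s² ≤ r̄_K · ∏_{j<K}(1+X_j) · m` (`landscape_le_telescope`) and Cauchy–Schwarz
under the slice law `m(Y)dY` give `E_Q[R_T] ≤ (E_m r̄_K²)^{1/2} (E_m (∏_{j<K}(1+X_j))²)^{1/2}`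
(`twoReplica_of_kinetic`, proved below). The UV factor `E_m[r̄_K²]` (`KineticScaleFlatnessBeyond`)
is reduced to the Born-weighted second moment of the WITHIN-BLOCK participation of the block holding
the tagged particle (`BlockParticipationBornMoment`; reduction = registered stub
`stub_flatnessOfBlockParticipation`, two finite Cauchy–Schwarz steps), which the line's lever
(`stub_shiftHarnack`: semigroup split at a horizon `τ₀ ≍ κ/ρ` + Cameron–Martin ramp of the TAGGED
world-line + Jensen under the tilted law, Born average = `2T`-bridge expectation) is to derive from
two bridge-form inputs (`LocalCrowdingBridge`, `TaggedDisplacementMoments`). The IR factor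
(`CoarseSecondMomentBeyond`: `∏_{j<K}(1+X_j) = 8^K S_K/s²` is the ACROSS-block participation of the
coarse-grained slice) is the crux's infrared heart at block resolution; this line types it once and
does not attack it.

**Registered stubs** (skeleton `twoReplicaTransienceBound_proof_skeleton`; 4 open + 2 bookkeeping):
`stub_localCrowdingBridge`, `stub_taggedDisplacement`, `stub_shiftHarnack` (the lever, target
`BlockParticipationBornMoment`), `stub_coarseSecondMomentBeyond` (OPEN); `stub_flatnessOfBlockParticipation`
(`BlockParticipationBornMoment → KineticScaleFlatnessBeyond`, proved in
`Theorems/BECCutLineWeakDisorderTaggedShiftBlockReduction.lean`) and `stub_taggedShiftCompose`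
(the six statements ⇒ the crux BY NAME, proved HERE).

References (for the objects, not for any claim): B. Simon, *Schrödinger semigroups*, Bull. AMS 7
(1982) §A1 (A7) (the witnesses); E. Bolthausen, CMP 123 (1989) (the second moment `E_m[R]`);
F.-Y. Wang, *Harnack inequalities for SPDEs* (2013) Thm 1.1.1 (log-Harnack by change of measure).
-/

noncomputable section

open MeasureTheory Filter Set Finset
open scoped ENNReal NNReal Topology BigOperators

namespace Summit.AtomisticToContinuum.BoseEinsteinCondensation.Cruxes.TwoReplicaTransienceBound.TaggedShiftLogHarnack

open Literature.MathematicalPhysics.QuantumManyBody.BoseGas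
open Summit.AtomisticToContinuum.BoseEinsteinCondensation.Theses.BECCutLineWeakDisorder
open Summit.AtomisticToContinuum.BoseEinsteinCondensation.Cruxes.LandscapeBound.SiblingTelescopingChaining

variable {n : ℕ}

/-! ### Vocabulary: the kinetic depth, block Born masses, within-block participations -/

/-- The dyadic level whose blocks have side `≈ √(κ/ρ)` (the KINETIC length of constant `κ`: a
tagged line diffusing across such a block during the time `κ/ρ` meets `O(κ)` mean-free times):
`depth L - ⌊log₂ ⌊√(κ/ρ)⌋⌋`, blocks of side `L·2^{-K} ∈ (√(κ/ρ)/16, √(κ/ρ)]` once `κ/ρ ≥ 1`, `L ≥ 1`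
(natural subtraction: never finer than the sibling's unit scale `depth L`). -/
def kineticDepth (κ ρ L : ℝ) : ℕ := depth L - Nat.log 2 ⌊Real.sqrt (κ / ρ)⌋₊

/-- `kineticDepth ≤ depth`. -/
theorem kineticDepth_le_depth (κ ρ L : ℝ) : kineticDepth κ ρ L ≤ depth L := Nat.sub_le _ _

/-- `m_Q = ∫_Q g²`: the `L²`-mass (Born mass, for a slice `g = |Ψ(·,Y)|`) carried by the dyadic
block `Q` of level `j` and multi-index `i`. -/
def blockSqMass (g : Space → ℝ≥0∞) (L : ℝ) (j : ℕ) (i : Fin 3 → Fin (2 ^ j)) : ℝ≥0∞ :=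
  ∫⁻ x in dyadicCube L j i, g x ^ 2

/-- **Within-block participation ratio** `P_Q = ℓ_j³ m_Q / a_Q²` of `g` on the block `Q`
(`ℓ_j = L 2^{-j}`, `a_Q = ∫_Q g = blockMass`, `m_Q = ∫_Q g² = blockSqMass`): `≥ 1` by Cauchy–Schwarz
whenever `0 < a_Q < ∞`, `= 1` iff `g` is a.e. constant on `Q`; `ENNReal` junk: `⊤` if
`a_Q = 0 < m_Q`, `0` if `a_Q = m_Q = 0`. The `a_Q²`-weighted HARMONIC mean of the `P_Q` over the
level is `r̄_j = uvParticipation g L j`. -/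
def blockParticipation (g : Space → ℝ≥0∞) (L : ℝ) (j : ℕ) (i : Fin 3 → Fin (2 ^ j)) : ℝ≥0∞ :=
  ENNReal.ofReal ((L / 2 ^ j) ^ 3) * blockSqMass g L j i / blockMass g L j i ^ 2

/-! ### The statements of the line -/

/-- STUB `stub_localCrowdingBridge` — **local crowding: exponential moments of the number of bath
lines within range `R` of a point displaced by `‖z‖ ≤ √(κ/ρ)` from the tagged line, at the bridge
times `T + s`, `s ∈ [0, κ/ρ]`, under the law of the `2T`-BRIDGE (`T ≥ κ/ρ`), uniformly in `n`, `T`,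
`s`, `z`; quantifier order `∃ρ₀ ∀Λ` (triage r2-2 (E): the lever consumes it at `Λ ≍ κ‖v‖_∞/ρ`).**
The bridge functional is the `2T`-long flat-datum system (`fkWeight v L (2T)` under
`dX₀ ⊗ wienerPaths`), normalised by its total mass `‖e^{-TH}1‖₂² = fkNormSq v L T 1`
(`lintegral_mul_lintegral_fkWeight_two_mul`); its one-time marginals are `∝ φ_{T+s}φ_{T-s} dX`.
Hard cores: packing (the count is `≤ C(R/R₀)³` a.s.); `v ≡ 0`: binomial counts under a product law
of one-body density `≤ C/L³`; bounded soft `v`: Feynman–Kac superstability of the bridge marginals at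
every polymer length (Ruelle / Park type) — the content. -/
def LocalCrowdingBridge : Prop :=
  ∀ v : ℝ → ℝ≥0∞, IsRepulsiveFiniteRange v → ∀ R κ : ℝ, 0 < R → 0 < κ →
    ∃ ρ₀ : ℝ, 0 < ρ₀ ∧ ∀ ρ : ℝ, 0 < ρ → ρ < ρ₀ → ∀ Λ : ℝ, 0 ≤ Λ → ∃ C : ℝ, 0 < C ∧
      ∀ᶠ n : ℕ in atTop, ∀ T : ℝ, κ / ρ ≤ T → ∀ s : ℝ, 0 ≤ s → s ≤ κ / ρ →
        ∀ z : Space, ‖z‖ ≤ Real.sqrt (κ / ρ) →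
          ∫⁻ X₀ : Config (n + 1), ∫⁻ ω,
              fkWeight v (sideLength ρ (n + 1)) (2 * T) X₀ ω *
                ENNReal.ofReal (Real.exp (Λ * ((Finset.univ.filter fun j : Fin (n + 1) =>
                  j ≠ 0 ∧ dist (worldLine X₀ ω (T + s).toNNReal j)
                    (worldLine X₀ ω (T + s).toNNReal 0 + z) < R).card : ℝ)))
            ∂wienerPaths (n + 1) ≤
          ENNReal.ofReal C * fkNormSq (N := n + 1) v (sideLength ρ (n + 1)) T (fun _ => (1 : ℝ≥0∞))

/-- STUB `stub_taggedDisplacement` — **Gaussian exponential moments of the tagged line's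
displacement over an early window `[T, T + τ]`, `τ ≤ κ/ρ`, after the cut, at the diffusive scale,
under the law of the `2T`-bridge (`T ≥ κ/ρ`), uniformly in `n`, `T`, `τ`.** Free gas: heat-kernel
Gaussian tails; interacting: the drift `2∇₀ log φ_{T-s}` only repels from contacts and walls
(Lyons–Zheng forward/backward decomposition + Khas'minskii for the contact singularity). It prices
the Cameron–Martin factor of the lever at FIXED exponents `a`. -/
def TaggedDisplacementMoments : Prop :=
  ∀ v : ℝ → ℝ≥0∞, IsRepulsiveFiniteRange v → ∀ κ a : ℝ, 0 < κ → 0 ≤ a →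
    ∃ ρ₀ : ℝ, 0 < ρ₀ ∧ ∀ ρ : ℝ, 0 < ρ → ρ < ρ₀ → ∃ C : ℝ, 0 < C ∧ ∀ᶠ n : ℕ in atTop,
      ∀ T : ℝ, κ / ρ ≤ T → ∀ τ : ℝ, 0 ≤ τ → τ ≤ κ / ρ →
        ∫⁻ X₀ : Config (n + 1), ∫⁻ ω,
            fkWeight v (sideLength ρ (n + 1)) (2 * T) X₀ ω *
              ENNReal.ofReal (Real.exp (a / Real.sqrt (τ + 1) *
                ‖worldLine X₀ ω (T + τ).toNNReal 0 - worldLine X₀ ω T.toNNReal 0‖))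
          ∂wienerPaths (n + 1) ≤
        ENNReal.ofReal (C * Real.exp (C * a ^ 2)) *
          fkNormSq (N := n + 1) v (sideLength ρ (n + 1)) T (fun _ => (1 : ℝ≥0∞))

/-- **`KineticScaleFlatnessBeyond`** — within-block flatness of the cut-line witness at the kinetic
scale BEYOND the kinetic time: second moment of the `a_Q²`-weighted within-block participation
`r̄_K = uvParticipation` at `K = kineticDepth κ ρ L` under the slice law `m(Y)dY`, uniformly in `n`
and in `T ≥ Aκ/ρ`, for every admissible `v` and every kinetic constant `κ ≤ κ₀(v)`. The UV factor
consumed by the composition `twoReplica_of_kinetic`; supplied from `BlockParticipationBornMoment` by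
`stub_flatnessOfBlockParticipation`. Free gas: the sine / erf block table (`(π²/8)³` at the top,
`→ 1` going down); `r̄ ≥ 1` is where the constant `C ≥ 1` of `Negative/ConstantAtLeastOne` lives. -/
def KineticScaleFlatnessBeyond : Prop :=
  ∀ v : ℝ → ℝ≥0∞, IsRepulsiveFiniteRange v → ∃ κ₀ : ℝ, 0 < κ₀ ∧ ∃ A : ℝ, 1 ≤ A ∧
    ∀ κ : ℝ, 0 < κ → κ ≤ κ₀ → ∃ ρ₀ : ℝ, 0 < ρ₀ ∧ ∀ ρ : ℝ, 0 < ρ → ρ < ρ₀ →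
      ∃ C : ℝ, 0 < C ∧ ∀ᶠ n : ℕ in atTop, ∀ T : ℝ, A * κ / ρ ≤ T →
        ∫⁻ Y : Config n,
            (∫⁻ x, slice (fkWitness (N := n + 1) v (sideLength ρ (n + 1)) T (fun _ => (1 : ℝ≥0∞))) Y x ^ 2) *
              uvParticipation
                (slice (fkWitness (N := n + 1) v (sideLength ρ (n + 1)) T (fun _ => (1 : ℝ≥0∞))) Y)
                (sideLength ρ (n + 1))
                (kineticDepth κ ρ (sideLength ρ (n + 1))) ^ 2 ≤
          ENNReal.ofReal C

/-- **`BlockParticipationBornMoment`** (the lever's target, lead a1 reshape) — the Born-weighted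
second moment of the within-block participation of the block holding the tagged particle, at the
kinetic depth, beyond the kinetic time: with `g_Y = |Ψ_T(·,Y)|`,
`∫ dY Σ_Q m_Q(g_Y) P_Q(g_Y)² = ∫∫ Ψ_T(x,Y)² P_{Q(x)}(g_Y)² dx dY ≤ C`, uniformly in `n` and
`T ≥ Aκ/ρ`, for every admissible `v` and `κ ≤ κ₀(v)` (same quantifier prefix as
`KineticScaleFlatnessBeyond`, which it implies: `m r̄_K² ≤ Σ_Q m_Q P_Q²` slice by slice). Per block
this is a local statement (one block of side `≤ √(κ/ρ)`, the slice's sup/inf oscillation over it,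
wall blocks through the linear Dirichlet vanishing whose participation is `≤ 4/3` per vanishing
direction, hard cores through core-excised lower masses); the Born weight is what turns tilted
polymer expectations at the apex into `2T`-bridge expectations. -/
def BlockParticipationBornMoment : Prop :=
  ∀ v : ℝ → ℝ≥0∞, IsRepulsiveFiniteRange v → ∃ κ₀ : ℝ, 0 < κ₀ ∧ ∃ A : ℝ, 1 ≤ A ∧
    ∀ κ : ℝ, 0 < κ → κ ≤ κ₀ → ∃ ρ₀ : ℝ, 0 < ρ₀ ∧ ∀ ρ : ℝ, 0 < ρ → ρ < ρ₀ →
      ∃ C : ℝ, 0 < C ∧ ∀ᶠ n : ℕ in atTop, ∀ T : ℝ, A * κ / ρ ≤ T →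
        ∫⁻ Y : Config n,
            ∑ i : Fin 3 → Fin (2 ^ kineticDepth κ ρ (sideLength ρ (n + 1))),
              blockSqMass
                  (slice (fkWitness (N := n + 1) v (sideLength ρ (n + 1)) T (fun _ => (1 : ℝ≥0∞))) Y)
                  (sideLength ρ (n + 1)) (kineticDepth κ ρ (sideLength ρ (n + 1))) i *
                blockParticipation
                  (slice (fkWitness (N := n + 1) v (sideLength ρ (n + 1)) T (fun _ => (1 : ℝ≥0∞))) Y)
                  (sideLength ρ (n + 1)) (kineticDepth κ ρ (sideLength ρ (n + 1))) i ^ 2 ≤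
          ENNReal.ofReal C

/-- STUB `stub_coarseSecondMomentBeyond` — **the infrared heart: second moment, under the slice law,
of the ACROSS-block participation of the coarse-grained slice at the kinetic length, beyond the
kinetic time, for every kinetic constant `κ`** (`∏_{j<K}(1 + X_j) = 8^K S_K/S_0`, `S_0 = s²`, is
the participation ratio `#blocks · Σ_Q a_Q²/(Σ_Q a_Q)²` of the block masses at level
`K = kineticDepth κ ρ L` whenever no `S_j` is junk; `X_j = siblingExcess`). Block-level ODLRO of
the witness `Ψ_T` — BEC-strength, `[difficulty: open-problem]` — the object common to cards
kinetic-block-bolthausen, slice-tensorisation-second-moment and across-cut-thinning; THIS line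
supplies its UV partner and does not attack it. Free gas: `≤ (π²/8)⁶`. -/
def CoarseSecondMomentBeyond : Prop :=
  ∀ v : ℝ → ℝ≥0∞, IsRepulsiveFiniteRange v → ∀ κ : ℝ, 0 < κ → ∃ ρ₀ : ℝ, 0 < ρ₀ ∧
    ∀ ρ : ℝ, 0 < ρ → ρ < ρ₀ → ∃ C : ℝ, 0 < C ∧ ∀ᶠ n : ℕ in atTop, ∀ T : ℝ, κ / ρ ≤ T →
      ∫⁻ Y : Config n,
          (∫⁻ x, slice (fkWitness (N := n + 1) v (sideLength ρ (n + 1)) T (fun _ => (1 : ℝ≥0∞))) Y x ^ 2) *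
            ENNReal.ofReal (∏ j ∈ Finset.range (kineticDepth κ ρ (sideLength ρ (n + 1))),
              (1 + siblingExcess
                (slice (fkWitness (N := n + 1) v (sideLength ρ (n + 1)) T (fun _ => (1 : ℝ≥0∞))) Y)
                (sideLength ρ (n + 1)) j)) ^ 2 ≤
        ENNReal.ofReal C

/-! ### Audit aliases (= the registered stub signatures, matched BY NAME by the skeleton audit) -/

namespace Goal

/-- Registered stub `stub_localCrowdingBridge`. -/
abbrev stub_localCrowdingBridge : Prop := LocalCrowdingBridge

/-- Registered stub `stub_taggedDisplacement`. -/
abbrev stub_taggedDisplacement : Prop := TaggedDisplacementMoments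

/-- Registered stub `stub_shiftHarnack` — THE LEVER (lead a1 reshape of the target): the two
bridge-form inputs imply the Born-weighted second moment of the within-block participation at the
kinetic scale beyond the kinetic time. -/
abbrev stub_shiftHarnack : Prop :=
  LocalCrowdingBridge → TaggedDisplacementMoments → BlockParticipationBornMoment

/-- Registered bookkeeping stub `stub_flatnessOfBlockParticipation` (lead a1): the harmonic-mean /
Cauchy–Schwarz reduction `m r̄_K² ≤ Σ_Q m_Q P_Q²` slice by slice. -/
abbrev stub_flatnessOfBlockParticipation : Prop :=
  BlockParticipationBornMoment → KineticScaleFlatnessBeyond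

/-- Registered stub `stub_coarseSecondMomentBeyond` (the IR heart; rank-2 difficulty, not this line's
device). -/
abbrev stub_coarseSecondMomentBeyond : Prop := CoarseSecondMomentBeyond

/-- Registered bookkeeping stub `stub_taggedShiftCompose`: the five stub statements imply the crux
`TwoReplicaTransienceBound` BY NAME (proved below as `stub_taggedShiftCompose`; registered so that the
shared vocabulary file lands as a `--supports` file, precedents `stub_tracerCompose`,
`stub_siblingCompose`). -/
abbrev stub_taggedShiftCompose : Prop :=
  stub_localCrowdingBridge → stub_taggedDisplacement → stub_shiftHarnack →
    stub_flatnessOfBlockParticipation → stub_coarseSecondMomentBeyond →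
      Summit.AtomisticToContinuum.BoseEinsteinCondensation.Theses.BECCutLineWeakDisorder.TwoReplicaTransienceBound

end Goal

/-! ### The composition (sorry-free): kinetic-depth telescoping + Cauchy–Schwarz + landed window -/

/-- **The crux from `KineticScaleFlatnessBeyond` and `CoarseSecondMomentBeyond`**: below the kinetic
time `Aκ/ρ` (`κ = min κ₀ (κ_w/A)`) the landed mean-free window `stub_meanFreeWindow` (constant `20`);
beyond it, telescoping at `K = kineticDepth κ ρ L` slice by slice (`landscape_le_telescope`), change
of measure to `m(Y)dY` and Cauchy–Schwarz between the UV factor `r̄_K` and the IR factor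
`∏_{j<K}(1+X_j)`; constants `ρ₀ = min`, `C = max (C_UV·C_IR + 1) 20`. (Planner's composition of the
checked skeleton, verbatim.) -/
theorem twoReplica_of_kinetic (hKS : KineticScaleFlatnessBeyond) (hIR : CoarseSecondMomentBeyond) :
    TwoReplicaTransienceBound := by
  intro v hv
  obtain ⟨κw, hκw, ρw, hρw, HW⟩ := TracerDecoupling.stub_meanFreeWindow v hv
  obtain ⟨κ₀, hκ₀, A, hA, HU⟩ := hKS v hv
  have hApos : 0 < A := one_pos.trans_le hA
  set κ : ℝ := min κ₀ (κw / A) with hκdef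
  have hκ : 0 < κ := lt_min hκ₀ (div_pos hκw hApos)
  have hκ₀' : κ ≤ κ₀ := min_le_left _ _
  have hκw' : A * κ ≤ κw := by
    have h1 : κ ≤ κw / A := min_le_right _ _
    rw [le_div_iff₀ hApos] at h1
    linarith [mul_comm κ A]
  obtain ⟨ρ₁, hρ₁, H1⟩ := HU κ hκ hκ₀'
  obtain ⟨ρ₂, hρ₂, H2⟩ := hIR v hv κ hκ
  refine ⟨min (min ρ₁ ρ₂) ρw, lt_min (lt_min hρ₁ hρ₂) hρw, fun ρ hρ hρlt => ?_⟩
  have hρ12 : ρ < min ρ₁ ρ₂ := hρlt.trans_le (min_le_left _ _)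
  obtain ⟨CU, hCU, ev1⟩ := H1 ρ hρ (hρ12.trans_le (min_le_left _ _))
  obtain ⟨CI, hCI, ev2⟩ := H2 ρ hρ (hρ12.trans_le (min_le_right _ _))
  have evW := HW ρ hρ (hρlt.trans_le (min_le_right _ _))
  refine ⟨max (CU * CI + 1) 20, lt_max_of_lt_left (by positivity), ?_⟩
  filter_upwards [ev1, ev2, evW] with n h1 h2 hW T hT
  rcases le_total T (A * κ / ρ) with hTle | hTge
  · -- inside the kinetic window: the landed crux bound
    have hTw : T ≤ κw / ρ := hTle.trans (div_le_div_of_nonneg_right hκw' hρ.le)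
    exact (hW T (zero_le_one.trans hT) hTw).trans (ENNReal.ofReal_le_ofReal (le_max_right _ _))
  -- beyond the kinetic time: telescoping at the kinetic depth + Cauchy–Schwarz
  have hTκ : κ / ρ ≤ T := by
    refine le_trans ?_ hTge
    rw [mul_div_assoc]
    exact le_mul_of_one_le_left (div_nonneg hκ.le hρ.le) hA
  have hvm : Measurable v := hv.1
  have hT0 : 0 ≤ T := zero_le_one.trans hT
  set L : ℝ := sideLength ρ (n + 1) with hLdef
  have hLpos : 0 < L := Real.rpow_pos_of_pos (div_pos (Nat.cast_pos.mpr n.succ_pos) hρ) _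
  set K : ℕ := kineticDepth κ ρ L with hKdef
  set Ψ : Config (n + 1) → ℝ := fkWitness (N := n + 1) v L T (fun _ => (1 : ℝ≥0∞)) with hΨdef
  set 𝒩 : ℝ≥0∞ := fkNormSq (N := n + 1) v L T (fun _ => (1 : ℝ≥0∞)) with h𝒩def
  have hΨm : Measurable Ψ := measurable_fkWitness hvm L T measurable_const
  -- the goal, in the slice vocabulary
  change ∫⁻ Y : Config n, ENNReal.ofReal (L ^ 3) * (∫⁻ x, slice Ψ Y x ^ 2) ^ 2 /
      (∫⁻ x, slice Ψ Y x) ^ 2 ≤ ENNReal.ofReal (max (CU * CI + 1) 20)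
  -- the slice law (no normalisation needed: Cauchy–Schwarz holds for any measure)
  set m : Config n → ℝ≥0∞ := fun Y => ∫⁻ x, slice Ψ Y x ^ 2 with hmdef
  have hm_meas : Measurable m := measurable_lintegral_slice_sq hΨm
  set μ : Measure (Config n) := volume.withDensity m with hμdef
  -- bound and support of the slices
  set Mr : ℝ := 1 / Real.sqrt 𝒩.toReal with hMrdef
  have hbound : ∀ Y x, slice Ψ Y x ≤ ENNReal.ofReal Mr := fun Y x => by
    show ((‖Ψ (Matrix.vecCons x Y)‖₊ : ℝ≥0∞)) ≤ ENNReal.ofReal Mr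
    rw [coe_nnnorm_fkWitness]
    exact ENNReal.ofReal_le_ofReal (fkWitness_one_le_inv_sqrt v L T _)
  have h0Y : ∀ (Y : Config n) (x : Space), x ∉ box L → slice Ψ Y x = 0 := fun Y x hx =>
    slice_fkWitness_eq_zero v hT0 _ Y hx
  -- pointwise telescoping at the kinetic depth
  set rbar : Config n → ℝ≥0∞ := fun Y => uvParticipation (slice Ψ Y) L K with hrbardef
  set Prd : Config n → ℝ := fun Y => ∏ j ∈ range K, (1 + siblingExcess (slice Ψ Y) L j) with hPrddef
  have hpt : ∀ Y, ENNReal.ofReal (L ^ 3) * (∫⁻ x, slice Ψ Y x ^ 2) ^ 2 / (∫⁻ x, slice Ψ Y x) ^ 2 ≤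
      m Y * (rbar Y * ENNReal.ofReal (Prd Y)) := by
    intro Y
    have h := landscape_le_telescope (measurable_slice hΨm Y) hLpos (h0Y Y)
      ENNReal.ofReal_ne_top (hbound Y) K
    calc _ ≤ _ := h
      _ = m Y * (rbar Y * ENNReal.ofReal (Prd Y)) := by simp only [hmdef, hrbardef, hPrddef]; ring
  have hrbar_meas : Measurable rbar := measurable_uvParticipation hΨm L K
  have hPrd_meas : Measurable Prd := by
    refine Finset.measurable_prod _ fun j _ => ?_
    exact (measurable_siblingExcess hΨm L j).const_add 1
  -- Cauchy–Schwarz under the slice law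
  have hCS : ∫⁻ Y, (rbar * fun Y => ENNReal.ofReal (Prd Y)) Y ∂μ ≤
      (∫⁻ Y, rbar Y ^ (2 : ℝ) ∂μ) ^ (1 / (2 : ℝ)) *
        (∫⁻ Y, ENNReal.ofReal (Prd Y) ^ (2 : ℝ) ∂μ) ^ (1 / (2 : ℝ)) :=
    ENNReal.lintegral_mul_le_Lp_mul_Lq μ Real.HolderConjugate.two_two hrbar_meas.aemeasurable
      (ENNReal.measurable_ofReal.comp hPrd_meas).aemeasurable
  -- the UV factor: kinetic-scale flatness beyond the kinetic time
  have hUVfac : ∫⁻ Y, rbar Y ^ (2 : ℝ) ∂μ ≤ ENNReal.ofReal CU := by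
    simp only [ENNReal.rpow_two]
    rw [hμdef, lintegral_withDensity_eq_lintegral_mul _ hm_meas (hrbar_meas.pow_const 2)]
    exact h1 T hTge
  -- the IR factor: the coarse second moment beyond the kinetic time
  have hIRfac : ∫⁻ Y, ENNReal.ofReal (Prd Y) ^ (2 : ℝ) ∂μ ≤ ENNReal.ofReal CI := by
    simp only [ENNReal.rpow_two]
    rw [hμdef, lintegral_withDensity_eq_lintegral_mul _ hm_meas
      (show Measurable (fun Y => ENNReal.ofReal (Prd Y) ^ 2) from
        (ENNReal.measurable_ofReal.comp hPrd_meas).pow_const 2)]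
    exact h2 T hTκ
  -- assemble
  calc ∫⁻ Y, ENNReal.ofReal (L ^ 3) * (∫⁻ x, slice Ψ Y x ^ 2) ^ 2 / (∫⁻ x, slice Ψ Y x) ^ 2
      ≤ ∫⁻ Y, m Y * (rbar Y * ENNReal.ofReal (Prd Y)) := lintegral_mono hpt
    _ = ∫⁻ Y, (rbar * fun Y => ENNReal.ofReal (Prd Y)) Y ∂μ := by
        rw [hμdef, lintegral_withDensity_eq_lintegral_mul _ hm_meas
          (show Measurable (rbar * fun Y => ENNReal.ofReal (Prd Y)) from
            hrbar_meas.mul (ENNReal.measurable_ofReal.comp hPrd_meas))]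
        rfl
    _ ≤ (∫⁻ Y, rbar Y ^ (2 : ℝ) ∂μ) ^ (1 / (2 : ℝ)) *
          (∫⁻ Y, ENNReal.ofReal (Prd Y) ^ (2 : ℝ) ∂μ) ^ (1 / (2 : ℝ)) := hCS
    _ ≤ (ENNReal.ofReal CU) ^ (1 / (2 : ℝ)) * (ENNReal.ofReal CI) ^ (1 / (2 : ℝ)) := by
        gcongr
    _ = (ENNReal.ofReal (CU * CI)) ^ (1 / (2 : ℝ)) := by
        rw [← ENNReal.mul_rpow_of_nonneg _ _ (by norm_num : (0:ℝ) ≤ 1 / 2),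
          ← ENNReal.ofReal_mul hCU.le]
    _ ≤ ENNReal.ofReal (CU * CI) + 1 := rpow_half_le_add_one _
    _ = ENNReal.ofReal (CU * CI + 1) := by
        rw [ENNReal.ofReal_add (by positivity) zero_le_one, ENNReal.ofReal_one]
    _ ≤ ENNReal.ofReal (max (CU * CI + 1) 20) := ENNReal.ofReal_le_ofReal (le_max_left _ _)

/-! ### The crux BY NAME from the registered stubs -/

/-- **`TwoReplicaTransienceBound` (stmt-AtomisticToContinuum-9687) BY NAME from the five stub
statements** (kernel-checked, sorry-free composition of the line: the lever turns the two inputs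
into `BlockParticipationBornMoment`, the block reduction turns that into
`KineticScaleFlatnessBeyond`, and `twoReplica_of_kinetic` closes with the IR stub). -/
theorem TwoReplicaTransienceBound_of :
    Goal.stub_localCrowdingBridge → Goal.stub_taggedDisplacement → Goal.stub_shiftHarnack →
      Goal.stub_flatnessOfBlockParticipation → Goal.stub_coarseSecondMomentBeyond →
        Summit.AtomisticToContinuum.BoseEinsteinCondensation.Theses.BECCutLineWeakDisorder.TwoReplicaTransienceBound :=
  fun hC hD hS hF hIR => twoReplica_of_kinetic (hF (hS hC hD)) hIR

/-- PROVED bookkeeping stub `stub_taggedShiftCompose` (= `TwoReplicaTransienceBound_of`). -/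
theorem stub_taggedShiftCompose : Goal.stub_taggedShiftCompose := TwoReplicaTransienceBound_of

end Summit.AtomisticToContinuum.BoseEinsteinCondensation.Cruxes.TwoReplicaTransienceBound.TaggedShiftLogHarnack

end
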